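import Literature.Analysis.Fourier.ConvolutionOperatorSymbol
import Mathlib.RingTheory.RootsOfUnity.Complex
import Mathlib.Data.Int.Interval
import Mathlib.Analysis.SpecialFunctions.Trigonometric.Bounds
import HarnessLib

/-!
# Momenta of characters of a finite abelian group and the momentum-cube count

Bookkeeping for volume-uniform bounds on convolution operators (used by the finite-range
decomposition, `FiniteRangeDecompositionVolumeUniform.lean`): for a character `ψ : AddChar G ℂ` and an
element `g` with `L • g = 0`, `ψ g` is an `L`-th root of unity, `ψ g = e^{2πi t}` with the **momentum**
`t = addCharMomentum L g ψ ∈ (−1/2, 1/2]`, `tL ∈ ℤ` (`addCharIndex`); the Laplacian symbol along `g` is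
`2 − 2Re ψ(g) = 4 sin²(πt) ≥ 16t²` (`two_sub_two_re_eq`, `sixteen_mul_sq_le`, Jordan).  If characters are
determined by their values on `e₀,…,e_{d−1}` (`L_i • e_i = 0`) then the number of characters in the
momentum cube `{|t_i| < ρ ∀ i}` is at most `Π_i (2L_iρ + 1)` (`card_filter_momentum_lt_le`, by injectivity
of `ψ ↦ (t_iL_i)_i`).  All [folklore]; cf. [cite: BauerschmidtBrydgesSlade2019, §1.5.1 (Fourier variables
on the discrete torus)].
-/

noncomputable section

open Finset Real
open Literature.Analysis.Fourier

namespace Literature.Analysis.Matrix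

variable {G : Type*} [AddCommGroup G]

/-! ## The momentum of a character along an element of finite order -/

section Momentum

/-- If `L • g = 0` then `ψ g` is an `L`-th root of unity: `ψ g = e^{2πi k/L}` for some `k < L`.
[folklore] -/
theorem exists_exp_eq_addChar_apply {L : ℕ} (hL : L ≠ 0) {g : G} (hg : L • g = 0) (ψ : AddChar G ℂ) :
    ∃ k : ℕ, k < L ∧ Complex.exp (2 * π * Complex.I * (((k : ℝ) / L : ℝ) : ℂ)) = ψ g := by
  haveI : NeZero L := ⟨hL⟩
  have hprim := Complex.isPrimitiveRoot_exp L hL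
  have hpow : (ψ g) ^ L = 1 := by rw [← AddChar.map_nsmul_eq_pow, hg, AddChar.map_zero_eq_one]
  obtain ⟨k, hk, hkeq⟩ := hprim.eq_pow_of_pow_eq_one hpow
  refine ⟨k, hk, ?_⟩
  rw [← hkeq, ← Complex.exp_nat_mul]
  congr 1
  push_cast
  field_simp

open Classical in
/-- The exponent `k < L` with `ψ g = e^{2πi k/L}` (junk value `0` unless `L ≠ 0` and `L • g = 0`).
[folklore] -/
def addCharExp (L : ℕ) (g : G) (ψ : AddChar G ℂ) : ℕ :=
  if h : L ≠ 0 ∧ L • g = 0 then Classical.choose (exists_exp_eq_addChar_apply h.1 h.2 ψ) else 0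

/-- The centred index `m ∈ (−L/2, L/2]` with `ψ g = e^{2πi m/L}`. [folklore] -/
def addCharIndex (L : ℕ) (g : G) (ψ : AddChar G ℂ) : ℤ :=
  if 2 * addCharExp L g ψ ≤ L then (addCharExp L g ψ : ℤ) else (addCharExp L g ψ : ℤ) - L

/-- The **momentum** `t = m/L ∈ (−1/2, 1/2]` of `ψ` along `g`: `ψ g = e^{2πi t}`. [folklore] -/
def addCharMomentum (L : ℕ) (g : G) (ψ : AddChar G ℂ) : ℝ := (addCharIndex L g ψ : ℝ) / L

variable {L : ℕ} (hL : L ≠ 0) {g : G} (hg : L • g = 0) (ψ : AddChar G ℂ)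
include hL hg

/-- The defining property of the exponent. [folklore] -/
theorem addCharExp_spec :
    addCharExp L g ψ < L ∧
      Complex.exp (2 * π * Complex.I * (((addCharExp L g ψ : ℝ) / L : ℝ) : ℂ)) = ψ g := by
  unfold addCharExp
  rw [dif_pos ⟨hL, hg⟩]
  exact Classical.choose_spec (exists_exp_eq_addChar_apply hL hg ψ)

/-- The defining property of the index: `ψ g = e^{2πi m/L}` with `−L < 2m ≤ L`. [folklore] -/
theorem addCharIndex_spec :
    Complex.exp (2 * π * Complex.I * (((addCharIndex L g ψ : ℝ) / L : ℝ) : ℂ)) = ψ g ∧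
      -(L : ℤ) < 2 * addCharIndex L g ψ ∧ 2 * addCharIndex L g ψ ≤ L := by
  obtain ⟨hk, hkeq⟩ := addCharExp_spec hL hg ψ
  set k := addCharExp L g ψ with hkdef
  unfold addCharIndex
  rw [← hkdef]
  split_ifs with h2
  · refine ⟨?_, ?_, ?_⟩
    · push_cast at hkeq ⊢
      exact hkeq
    · omega
    · exact_mod_cast h2
  · refine ⟨?_, ?_, ?_⟩
    · rw [← hkeq]
      have hLc : (L : ℂ) ≠ 0 := Nat.cast_ne_zero.mpr hL
      push_cast
      rw [show 2 * (π : ℂ) * Complex.I * (((k : ℂ) - L) / L)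
          = 2 * π * Complex.I * ((k : ℂ) / L) - 2 * π * Complex.I by
            rw [sub_div, div_self hLc]; ring,
        Complex.exp_sub, Complex.exp_two_pi_mul_I, div_one]
    · have h2' : L < 2 * k := not_le.mp h2
      omega
    · omega

/-- `ψ g = e^{2πi t}`. [folklore] -/
theorem exp_addCharMomentum :
    Complex.exp (2 * π * Complex.I * ((addCharMomentum L g ψ : ℝ) : ℂ)) = ψ g :=
  (addCharIndex_spec hL hg ψ).1

/-- `|t| ≤ 1/2`. [folklore] -/
theorem abs_addCharMomentum_le : |addCharMomentum L g ψ| ≤ 1 / 2 := by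
  obtain ⟨-, h1, h2⟩ := addCharIndex_spec hL hg ψ
  unfold addCharMomentum
  have hLr : (0 : ℝ) < L := Nat.cast_pos.mpr (Nat.pos_of_ne_zero hL)
  have h1' : -(L : ℝ) < 2 * (addCharIndex L g ψ : ℝ) := by exact_mod_cast h1
  have h2' : 2 * (addCharIndex L g ψ : ℝ) ≤ L := by exact_mod_cast h2
  rw [abs_le]
  constructor
  · rw [le_div_iff₀ hLr]; linarith
  · rw [div_le_iff₀ hLr]; linarith

/-- `Re ψ(g) = cos(2πt)`. [folklore] -/
theorem re_addChar_apply_eq_cos : (ψ g).re = Real.cos (2 * π * addCharMomentum L g ψ) := by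
  rw [← exp_addCharMomentum hL hg ψ,
    show 2 * (π : ℂ) * Complex.I * ((addCharMomentum L g ψ : ℝ) : ℂ)
      = ((2 * π * addCharMomentum L g ψ : ℝ) : ℂ) * Complex.I by push_cast; ring,
    Complex.exp_ofReal_mul_I_re]

/-- **The Laplacian symbol along `g`**: `2 − 2 Re ψ(g) = 4 sin²(πt)`. [folklore] -/
theorem two_sub_two_re_eq : 2 - 2 * (ψ g).re = 4 * Real.sin (π * addCharMomentum L g ψ) ^ 2 := by
  rw [re_addChar_apply_eq_cos hL hg ψ, show 2 * π * addCharMomentum L g ψ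
    = 2 * (π * addCharMomentum L g ψ) by ring, Real.cos_two_mul, Real.cos_sq']
  ring

/-- **Jordan**: `16 t² ≤ 2 − 2 Re ψ(g)` (since `|sin(πt)| ≥ 2|t|` for `|t| ≤ 1/2`). [folklore] -/
theorem sixteen_mul_sq_le : 16 * addCharMomentum L g ψ ^ 2 ≤ 2 - 2 * (ψ g).re := by
  rw [two_sub_two_re_eq hL hg ψ]
  have hxle := abs_addCharMomentum_le hL hg ψ
  -- `2y ≤ sin(πy)` on `[0, 1/2]`
  have key : ∀ y : ℝ, 0 ≤ y → y ≤ 1 / 2 → 2 * y ≤ Real.sin (π * y) := by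
    intro y hy0 hy1
    have h1 : 0 ≤ π * y := by positivity
    have h2 : π * y ≤ π / 2 := by nlinarith [Real.pi_pos]
    have := Real.mul_le_sin h1 h2
    calc 2 * y = 2 / π * (π * y) := by field_simp
      _ ≤ Real.sin (π * y) := this
  have hsq : 4 * addCharMomentum L g ψ ^ 2 ≤ Real.sin (π * addCharMomentum L g ψ) ^ 2 := by
    rcases le_or_gt 0 (addCharMomentum L g ψ) with h | h
    · have := key _ h (le_trans (le_abs_self _) hxle)
      nlinarith
    · have hx' : -addCharMomentum L g ψ ≤ 1 / 2 := le_trans (neg_le_abs _) hxle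
      have := key _ (by linarith) hx'
      simp only [mul_neg, Real.sin_neg] at this
      nlinarith
  linarith

/-- `0 ≤ 2 − 2 Re ψ(g)`. [folklore] -/
theorem two_sub_two_re_nonneg : 0 ≤ 2 - 2 * (ψ g).re :=
  le_trans (by positivity) (sixteen_mul_sq_le hL hg ψ)

/-- The index determines `ψ g`. [folklore] -/
theorem addChar_apply_eq_of_index_eq (φ : AddChar G ℂ) (h : addCharIndex L g ψ = addCharIndex L g φ) :
    ψ g = φ g := by
  rw [← (addCharIndex_spec hL hg ψ).1, ← (addCharIndex_spec hL hg φ).1, h]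

omit hg in
/-- `|m| < L ρ` when `|t| < ρ`. [folklore] -/
theorem abs_addCharIndex_lt {ρ : ℝ} (h : |addCharMomentum L g ψ| < ρ) :
    |(addCharIndex L g ψ : ℝ)| < L * ρ := by
  unfold addCharMomentum at h
  have hLr : (0 : ℝ) < L := Nat.cast_pos.mpr (Nat.pos_of_ne_zero hL)
  rw [abs_div, abs_of_pos hLr, div_lt_iff₀ hLr] at h
  linarith

end Momentum

variable [Fintype G]

/-! ## Counting characters in a momentum cube -/

/-- **Cube count.**  If characters are determined by their values on `e₀,…,e_{d−1}` (`L_i • e_i = 0`),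
then `#{ψ : |t_i(ψ)| < ρ ∀ i} ≤ Π_i (2 L_i ρ + 1)`. [folklore] -/
theorem card_filter_momentum_lt_le {d : ℕ} (e : Fin d → G) (Ls : Fin d → ℕ) (hL : ∀ i, Ls i ≠ 0)
    (he : ∀ i, Ls i • e i = 0) (hgen : ∀ ψ φ : AddChar G ℂ, (∀ i, ψ (e i) = φ (e i)) → ψ = φ)
    {ρ : ℝ} (hρ : 0 < ρ) :
    ((Finset.univ.filter fun ψ : AddChar G ℂ => ∀ i, |addCharMomentum (Ls i) (e i) ψ| < ρ).card : ℝ)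
      ≤ ∏ i, (2 * (Ls i : ℝ) * ρ + 1) := by
  classical
  set K : Fin d → ℤ := fun i => ⌈(Ls i : ℝ) * ρ⌉ with hK
  set f : AddChar G ℂ → (Fin d → ℤ) := fun ψ i => addCharIndex (Ls i) (e i) ψ with hf
  set S := Finset.univ.filter fun ψ : AddChar G ℂ => ∀ i, |addCharMomentum (Ls i) (e i) ψ| < ρ with hS
  set T := Fintype.piFinset fun i => Finset.Ioo (-K i) (K i) with hT
  have hmaps : ∀ ψ ∈ S, f ψ ∈ T := by
    intro ψ hψ
    rw [hS, Finset.mem_filter] at hψ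
    rw [hT, Fintype.mem_piFinset]
    intro i
    have hlt := abs_addCharIndex_lt (hL i) ψ (hψ.2 i)
    have hceil : (Ls i : ℝ) * ρ ≤ (K i : ℝ) := Int.le_ceil _
    have habs : |(addCharIndex (Ls i) (e i) ψ : ℝ)| < K i := lt_of_lt_of_le hlt hceil
    rw [abs_lt] at habs
    rw [Finset.mem_Ioo]
    constructor
    · exact_mod_cast habs.1
    · exact_mod_cast habs.2
  have hinj : Set.InjOn f S := by
    intro ψ _ φ _ hψφ
    apply hgen
    intro i
    exact addChar_apply_eq_of_index_eq (hL i) (he i) ψ φ (congrFun hψφ i)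
  have hcard := Finset.card_le_card_of_injOn f hmaps hinj
  have hT' : (T.card : ℝ) ≤ ∏ i, (2 * (Ls i : ℝ) * ρ + 1) := by
    rw [hT, Fintype.card_piFinset]
    push_cast
    refine Finset.prod_le_prod (fun i _ => by positivity) fun i _ => ?_
    have hKpos : 0 < K i :=
      Int.ceil_pos.mpr (mul_pos (Nat.cast_pos.mpr (Nat.pos_of_ne_zero (hL i))) hρ)
    have hcardI : ((Finset.Ioo (-K i) (K i)).card : ℝ) = 2 * (K i : ℝ) - 1 := by
      have h := Int.card_Ioo_of_lt (-K i) (K i) (by omega)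
      have h' : (((Finset.Ioo (-K i) (K i)).card : ℤ) : ℝ) = ((K i - -K i - 1 : ℤ) : ℝ) := by
        exact_mod_cast h
      push_cast at h'
      linarith
    rw [hcardI]
    have hceil : (K i : ℝ) < (Ls i : ℝ) * ρ + 1 := Int.ceil_lt_add_one _
    linarith
  calc (S.card : ℝ) ≤ T.card := by exact_mod_cast hcard
    _ ≤ _ := hT'

end Literature.Analysis.Matrix

end
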